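import Summits.QuantumFields.YangMills.Theorems.AllWindowsColdBoxBoxHighLineTiltCum4BoundPrelims
import Summits.QuantumFields.YangMills.Theorems.AllWindowsColdBoxBoxHighLineTiltUEvenL2

/-!
# T-S5.13K-K4 — the fourth tilted cumulant `κ₄,t(c_x, c_y; U, U)` over `μ_D` in explicit sizes
# (ASSEMBLY-S5 §6 (e5); LEAD sfw-p2 g77's ε₂-memo STEP 3 packaged; LINE-19 S5 ⟨stmt-QuantumFields-24004⟩/⟨24335⟩, LINE-20 U5 ⟨24336⟩)

Width seat `ym-line-sfw-p2-w5` (prover-ym-line-sfw-p2-w5-g23-0).  The `hK` hypothesis of ✓13u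
`GaussNormalForm.abs_tiltCov_sub_sub_tiltCum3_le_muD` (fcl-p3 g26) asks for a bound, uniform in `t ∈ [0,1]`, on

  `|Tilt.tiltCum4 μ_D (tiltU β H) t (chartPlaqCost H x 1 2) (chartPlaqCost H y 1 2)|`,
  `μ_D := (volume.restrict (smallField H s)).withDensity (ofReal ∘ gaussWeight β H)`.

This file delivers it BY NAME from the landed bricks, with the one size that is not yet a tree theorem — fcl-p3's 13K-U
`E₀[1_D·(tiltU + cubicVertex − b)²] ≤ RU` — entering ONLY as a hypothesis (so nothing of 13K-U is restated):

* ★ `GaussNormalForm.abs_tiltCum4_muD_le_of_sizes` — for `H ≥ 1`, `H⁴ ≤ β`, `0 ≤ s ≤ 1`, `sup_D |tiltU| ≤ 1` (✓13s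
  `TiltSup.exists_forall_abs_tiltU_le_one`), `E₀[1_D] ≥ 1/2` (✓6g `gaussianSmallFieldTail` for `β` large) and any `b`, `RU ≥ 0` with
  `E₀[1_D·(tiltU + V₃ − b)²] ≤ RU`:
  `|κ₄,t| ≤ C·(1+log H)^m·(H⁴/β³ + s⁶·H⁴/β + (s² + 1/β)²·RU)` for all `t ∈ [0,1]` and all base points `x, y`;
* ★★ `GaussNormalForm.abs_tiltCum4_muD_le_explicit` — the same with `RU` DISCHARGED by fcl-p3's ✓13K-U
  `gaussAvg_sfInd_mul_sq_tiltU_add_cubicVertex_sub_le` (unconditional over ✓7d `ghostTaylor`): under `s·H² ≤ c₀` in addition,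
  `|κ₄,t| ≤ C·(1+log H)^m·(H⁴/β³ + s⁶·H⁴/β + (s² + 1/β)²·(H⁸/β² + H¹²·s⁶ + H⁸·s⁸))` — memo STEP 3 fully BY NAME
  (in the §1 letters `s = β^{−1/2+κ₃}`, `H ≤ β^θ + 1` the leading term is `H⁴(1+log H)^m/β³`, relative size `H¹²(1+log H)^m/β`, cf. (e5));
* ★★ `GaussNormalForm.abs_tiltCum4_muD_le_rpow` — the same in the §1 letters `s = β^{−1/2+κ₃}` (`0 ≤ κ₃ ≤ 1/6`): three monomials
  `C(1+log H)^m·(2H⁴/β³ + 8H⁸β^{−4+4κ₃} + 4H¹²β^{−5+10κ₃})` ready for w2's ✓`ErrorBudget.exists_forall_natPow_log_le` (pure arithmetic `k4_sizes_rpow_le`).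

Route: ✓`Tilt.tiltCum4_congr_ae` (`tiltU ↦ Ũ := 1_D·tiltU`, `|Ũ| ≤ 1` everywhere), ✓`Tilt.abs_tiltCum4_le_of_moments` (w5 g22) with the five
tilted moments transferred to `gaussAvg` letters by ✓`Tilt.tiltExp_muD_le_gaussAvg` (factor `e^{2t} ≤ e²`) and `E₀[1_D·Y]/E₀[1_D] ≤ 2·E₀[1_D·Y]`;
then the sizes ✓13K-G (w4 g28) `TiltSup.gaussAvg_sfInd_mul_sq_chartPlaqCost_sub_mean_le` (`m`-slots, centre `a₁ = E₀|ℓ_p|²`),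
`TiltSup.gaussAvg_sfInd_mul_sq_mul_sq_le` (`p`-slots, `W := Ũ`), and for the `U`-slot `1_D(Ũ−b)² ≤ 2V₃² + 2·1_D(tiltU+V₃−b)²` with ✓12a
`cubicVariance` (✓`…TiltCum4BoundPrelims`, this seat).

Everything proved; no definitions; standard axioms.  HONEST LABEL: a support brick for the OPEN assembly T-S5.13 of the XL stub S5
(`stub_landauSecondOrder`) of a critic-PASSed DRAFT line; S5, U5, ⟨24004⟩ ⟨24335⟩ ⟨24336⟩ remain OPEN; no crux, rung or summit is proved;
**the Yang–Mills mass gap is NOT proved by this file; no summit is proved by a line.**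
-/

set_option autoImplicit false

noncomputable section

open MeasureTheory Set Real
open Literature.Probability.LatticeModels (Site)
open Summit.QuantumFields.YangMills.Theorems.WeakCouplingRates (plaq12At)

namespace Summit.QuantumFields.YangMills.Theorems.AllWindowsColdBoxBoxHighLine

namespace GaussNormalForm

variable {H : ℕ}

/-! ## The fourth cumulant in explicit sizes -/

/-- ★ **`κ₄,t` over `μ_D` in explicit sizes** (ASSEMBLY-S5 §6 (e5); the `hK` of ✓`abs_tiltCov_sub_sub_tiltCum3_le_muD`).
There are `C ≥ 0` and `m` such that for `H ≥ 1`, `H⁴ ≤ β`, `0 ≤ s ≤ 1`, `|tiltU β H| ≤ 1` on `smallField H s`, `E₀[1_{smallField s}] ≥ 1/2`,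
and every `b`, `RU ≥ 0` with `E₀[1_D·(tiltU + cubicVertex − b)²] ≤ RU` (fcl-p3's 13K-U quantity), for all base points `x, y` and all `t ∈ [0,1]`:
`|κ₄,t(c_x, c_y; tiltU, tiltU)| ≤ C·(1 + log H)^m·(H⁴/β³ + s⁶H⁴/β + (s² + 1/β)²·RU)`. -/
theorem abs_tiltCum4_muD_le_of_sizes : ∃ C : ℝ, ∃ m : ℕ, 0 ≤ C ∧ ∀ H : ℕ, 1 ≤ H → ∀ β : ℝ, (H : ℝ) ^ 4 ≤ β →
    ∀ s : ℝ, 0 ≤ s → s ≤ 1 → (∀ a ∈ smallField H s, |tiltU β H a| ≤ 1) → 1 / 2 ≤ gaussAvg β H (sfInd H s) →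
    ∀ b RU : ℝ, 0 ≤ RU → gaussAvg β H (fun a => sfInd H s a * (tiltU β H a + cubicVertex β H a - b) ^ 2) ≤ RU →
    ∀ (x y : Site 4), ∀ t ∈ Set.Icc (0 : ℝ) 1,
      |Tilt.tiltCum4 ((volume.restrict (smallField H s)).withDensity fun a => ENNReal.ofReal (gaussWeight β H a))
          (tiltU β H) t (chartPlaqCost H x 1 2) (chartPlaqCost H y 1 2)| ≤
        C * (1 + Real.log H) ^ m * ((H : ℝ) ^ 4 / β ^ 3 + s ^ 6 * (H : ℝ) ^ 4 / β + (s ^ 2 + 1 / β) ^ 2 * RU) := by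
  obtain ⟨C_G, hC_G0, hG2⟩ := TiltSup.gaussAvg_sfInd_mul_sq_chartPlaqCost_sub_mean_le
  obtain ⟨C_3, m_3, hC_30, hG3⟩ := TiltSup.gaussAvg_sfInd_mul_sq_mul_sq_le
  obtain ⟨C₁₂, m₁₂, h12a⟩ := cubicVariance
  refine ⟨(64 * C_3 + 7680 * C_G * max C₁₂ 0 + 1722368 + 7680 * C_G) * Real.exp 2 ^ 2, m_3 + m₁₂ + 2, by positivity,
    fun H hH β hβ s hs0 hs1 hU1 hD b RU hRU0 hRU x y t ht => ?_⟩
  obtain ⟨ht0, ht1⟩ := ht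
  have hH1 : (1 : ℝ) ≤ H := by exact_mod_cast hH
  have hH4 : (1 : ℝ) ≤ (H : ℝ) ^ 4 := one_le_pow₀ hH1
  have hβ1 : 1 ≤ β := hH4.trans hβ
  have hβ0 : 0 < β := lt_of_lt_of_le one_pos hβ1
  have hL1 : 1 ≤ 1 + Real.log (H : ℝ) := by have := Real.log_nonneg hH1; linarith
  have hDpos := integral_sfInd_mul_gaussWeight_pos (H := H) hβ0 hD
  haveI := Tilt.isFiniteMeasure_muD H hβ0 s
  haveI := Tilt.neZero_muD H hβ0 hDpos
  -- the truncation `Ũ = 1_D·tiltU`, bounded by `1` everywhere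
  have hmU : Measurable ((smallField H s).indicator (tiltU β H)) := (measurable_tiltU β H).indicator (ChartGauss.measurableSet_smallField s)
  have hUb : ∀ a, |(smallField H s).indicator (tiltU β H) a| ≤ 1 := fun a => Tilt.abs_indicator_le zero_le_one hU1 a
  have hUD : ∀ a ∈ smallField H s, |(smallField H s).indicator (tiltU β H) a| ≤ 1 := fun a _ => hUb a
  have hm₁ : Measurable (chartPlaqCost H x 1 2) := EdgeChartGaussian.measurable_chartPlaqCost H x 1 2
  have hm₂ : Measurable (chartPlaqCost H y 1 2) := EdgeChartGaussian.measurable_chartPlaqCost H y 1 2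
  have h₁b : ∀ a, |chartPlaqCost H x 1 2 a| ≤ 4 := fun a => TiltSup.abs_chartPlaqCost_le_four (H := H) x 1 2 a
  have h₂b : ∀ a, |chartPlaqCost H y 1 2 a| ≤ 4 := fun a => TiltSup.abs_chartPlaqCost_le_four (H := H) y 1 2 a
  have hsf := fun a : LandauFree H → E3 => TiltSup.sfInd_nonneg_le_one (H := H) s a
  -- the sizes of the five numerators (before any tilted quantity enters the context)
  have Sm₁ := hG2 H hH β hβ1 s x
  have Sm₂ := hG2 H hH β hβ1 s y
  have SU₀ := gaussAvg_sfInd_mul_sq_indicator_sub_le H hβ0 s zero_le_one hU1 b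
  have hV2 := h12a H hH β hβ
  have hV2' : gaussAvg β H (fun a => cubicVertex β H a ^ 2) ≤ max C₁₂ 0 * ((H : ℝ) ^ 4 / β) * (1 + Real.log H) ^ m₁₂ := by
    refine hV2.trans ?_
    have h0 : 0 ≤ ((H : ℝ) ^ 4 / β) * (1 + Real.log H) ^ m₁₂ := by positivity
    calc C₁₂ * (H : ℝ) ^ 4 * (1 + Real.log H) ^ m₁₂ / β = C₁₂ * (((H : ℝ) ^ 4 / β) * (1 + Real.log H) ^ m₁₂) := by ring
      _ ≤ max C₁₂ 0 * (((H : ℝ) ^ 4 / β) * (1 + Real.log H) ^ m₁₂) := mul_le_mul_of_nonneg_right (le_max_left _ _) h0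
      _ = _ := by ring
  have SU : gaussAvg β H (fun a => sfInd H s a * ((smallField H s).indicator (tiltU β H) a - b) ^ 2) ≤
      2 * (max C₁₂ 0 * ((H : ℝ) ^ 4 / β) * (1 + Real.log H) ^ m₁₂) + 2 * RU :=
    SU₀.trans (add_le_add (mul_le_mul_of_nonneg_left hV2' zero_le_two) (mul_le_mul_of_nonneg_left hRU zero_le_two))
  have hW : gaussAvg β H (fun a => sfInd H s a * ((smallField H s).indicator (tiltU β H) a + cubicVertex β H a - b) ^ 2) ≤ RU := by
    have e : (fun a => sfInd H s a * ((smallField H s).indicator (tiltU β H) a + cubicVertex β H a - b) ^ 2) =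
        fun a => sfInd H s a * (tiltU β H a + cubicVertex β H a - b) ^ 2 := by
      funext a; exact sfInd_mul_indicator_eq β s (fun u => (u + cubicVertex β H a - b) ^ 2) a
    rw [e]; exact hRU
  have hK2 : 0 ≤ 2 * (116 * s ^ 2 + 3 / (2 * β)) ^ 2 := by positivity
  have SP₁ : gaussAvg β H (fun a => sfInd H s a *
      ((chartPlaqCost H x 1 2 a - gaussAvg β H (linCurvSq H (plaq12At x))) ^ 2 * ((smallField H s).indicator (tiltU β H) a - b) ^ 2)) ≤
      C_3 * (1 + Real.log H) ^ m_3 * ((H : ℝ) ^ 4 / β ^ 3 + s ^ 6 * (H : ℝ) ^ 4 / β) + 2 * (116 * s ^ 2 + 3 / (2 * β)) ^ 2 * RU :=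
    (hG3 H hH β hβ s hs0 hs1 x _ 1 b hmU hUb).trans (add_le_add le_rfl (mul_le_mul_of_nonneg_left hW hK2))
  have SP₂ : gaussAvg β H (fun a => sfInd H s a *
      ((chartPlaqCost H y 1 2 a - gaussAvg β H (linCurvSq H (plaq12At y))) ^ 2 * ((smallField H s).indicator (tiltU β H) a - b) ^ 2)) ≤
      C_3 * (1 + Real.log H) ^ m_3 * ((H : ℝ) ^ 4 / β ^ 3 + s ^ 6 * (H : ℝ) ^ 4 / β) + 2 * (116 * s ^ 2 + 3 / (2 * β)) ^ 2 * RU :=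
    (hG3 H hH β hβ s hs0 hs1 y _ 1 b hmU hUb).trans (add_le_add le_rfl (mul_le_mul_of_nonneg_left hW hK2))
  -- integrability of the five observables against the Gaussian weight (bounded × weight)
  have b₁ := fun a => sq_sub_le_sq_add_abs (h₁b a) (gaussAvg β H (linCurvSq H (plaq12At x)))
  have b₂ := fun a => sq_sub_le_sq_add_abs (h₂b a) (gaussAvg β H (linCurvSq H (plaq12At y)))
  have bU := fun a => sq_sub_le_sq_add_abs (hUb a) b
  have bp : ∀ {G : (LandauFree H → E3) → ℝ} {r : ℝ}, (∀ a, |(G a - r) ^ 2| ≤ (4 + |r|) ^ 2) →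
      ∀ a, |(G a - r) ^ 2 * ((smallField H s).indicator (tiltU β H) a - b) ^ 2| ≤ (4 + |r|) ^ 2 * (1 + |b|) ^ 2 := by
    intro G r hb a
    rw [abs_mul]
    exact mul_le_mul (hb a) (bU a) (abs_nonneg _) ((abs_nonneg _).trans (hb a))
  have I₁ := Tilt.integrable_bdd_mul_gaussWeight H hβ0 ((hm₁.sub measurable_const).pow_const 2) b₁
  have I₂ := Tilt.integrable_bdd_mul_gaussWeight H hβ0 ((hm₂.sub measurable_const).pow_const 2) b₂
  have IU := Tilt.integrable_bdd_mul_gaussWeight H hβ0 ((hmU.sub measurable_const).pow_const 2) bU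
  have IP₁ := Tilt.integrable_bdd_mul_gaussWeight H hβ0
    (((hm₁.sub measurable_const).pow_const 2).mul ((hmU.sub measurable_const).pow_const 2)) (bp b₁)
  have IP₂ := Tilt.integrable_bdd_mul_gaussWeight H hβ0
    (((hm₂.sub measurable_const).pow_const 2).mul ((hmU.sub measurable_const).pow_const 2)) (bp b₂)
  -- `E₀[1_D·Y]/E₀[1_D] ≤ 2·E₀[1_D·Y]` and `e^{2t} ≤ e²`
  have hEle : Real.exp (2 * t * 1) ≤ Real.exp 2 := Real.exp_le_exp.2 (by linarith only [ht1])
  have step : ∀ {X S : ℝ}, 0 ≤ X → X ≤ S →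
      Real.exp (2 * t * 1) * (X / gaussAvg β H (sfInd H s)) ≤ Real.exp 2 * (2 * S) := by
    intro X S hX hXS
    have h1 : X / gaussAvg β H (sfInd H s) ≤ 2 * X := div_le_two_mul_of_half_le hX hD
    have hd0 : 0 ≤ gaussAvg β H (sfInd H s) := le_trans (by norm_num) hD
    have h2 : 0 ≤ X / gaussAvg β H (sfInd H s) := div_nonneg hX hd0
    have h3 : 2 * X ≤ 2 * S := mul_le_mul_of_nonneg_left hXS zero_le_two
    exact mul_le_mul hEle (h1.trans h3) h2 (Real.exp_pos 2).le
  have n₁ : 0 ≤ gaussAvg β H (fun a => sfInd H s a * (chartPlaqCost H x 1 2 a - gaussAvg β H (linCurvSq H (plaq12At x))) ^ 2) :=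
    EdgeChartGaussian.gaussAvg_nonneg H hβ0 fun a => mul_nonneg (hsf a).1 (sq_nonneg _)
  have n₂ : 0 ≤ gaussAvg β H (fun a => sfInd H s a * (chartPlaqCost H y 1 2 a - gaussAvg β H (linCurvSq H (plaq12At y))) ^ 2) :=
    EdgeChartGaussian.gaussAvg_nonneg H hβ0 fun a => mul_nonneg (hsf a).1 (sq_nonneg _)
  have nU : 0 ≤ gaussAvg β H (fun a => sfInd H s a * ((smallField H s).indicator (tiltU β H) a - b) ^ 2) :=
    EdgeChartGaussian.gaussAvg_nonneg H hβ0 fun a => mul_nonneg (hsf a).1 (sq_nonneg _)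
  have nP₁ : 0 ≤ gaussAvg β H (fun a => sfInd H s a *
      ((chartPlaqCost H x 1 2 a - gaussAvg β H (linCurvSq H (plaq12At x))) ^ 2 * ((smallField H s).indicator (tiltU β H) a - b) ^ 2)) :=
    EdgeChartGaussian.gaussAvg_nonneg H hβ0 fun a => mul_nonneg (hsf a).1 (mul_nonneg (sq_nonneg _) (sq_nonneg _))
  have nP₂ : 0 ≤ gaussAvg β H (fun a => sfInd H s a *
      ((chartPlaqCost H y 1 2 a - gaussAvg β H (linCurvSq H (plaq12At y))) ^ 2 * ((smallField H s).indicator (tiltU β H) a - b) ^ 2)) :=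
    EdgeChartGaussian.gaussAvg_nonneg H hβ0 fun a => mul_nonneg (hsf a).1 (mul_nonneg (sq_nonneg _) (sq_nonneg _))
  -- slot nonnegativity (for the abstract bound's collapse)
  have hM0 : 0 ≤ Real.exp 2 * (2 * (C_G * (1 + Real.log H) ^ 2 / β ^ 2)) := by positivity
  have hMU0 : 0 ≤ Real.exp 2 * (2 * (2 * (max C₁₂ 0 * ((H : ℝ) ^ 4 / β) * (1 + Real.log H) ^ m₁₂) + 2 * RU)) := by positivity
  have hP0 : 0 ≤ Real.exp 2 * (2 * (C_3 * (1 + Real.log H) ^ m_3 * ((H : ℝ) ^ 4 / β ^ 3 + s ^ 6 * (H : ℝ) ^ 4 / β) +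
      2 * (116 * s ^ 2 + 3 / (2 * β)) ^ 2 * RU)) := by positivity
  -- replace `tiltU` by its truncation inside `κ₄`
  have hae : (smallField H s).indicator (tiltU β H) =ᵐ[(volume.restrict (smallField H s)).withDensity fun a => ENNReal.ofReal (gaussWeight β H a)]
      tiltU β H :=
    Tilt.indicator_ae_eq_of_ae_mem (Tilt.ae_muD_mem_smallField H β s) (tiltU β H)
  rw [← Tilt.tiltCum4_congr_ae hae (Filter.EventuallyEq.rfl (f := chartPlaqCost H x 1 2)) (Filter.EventuallyEq.rfl (f := chartPlaqCost H y 1 2)) t]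
  -- norm transfer for the five tilted moments, each immediately pushed to its slot
  have F₁ := (Tilt.tiltExp_muD_le_gaussAvg H hβ0 hDpos ht0 hmU hUD
    (fun a => sq_nonneg (chartPlaqCost H x 1 2 a - gaussAvg β H (linCurvSq H (plaq12At x)))) I₁).trans (step n₁ Sm₁)
  have F₂ := (Tilt.tiltExp_muD_le_gaussAvg H hβ0 hDpos ht0 hmU hUD
    (fun a => sq_nonneg (chartPlaqCost H y 1 2 a - gaussAvg β H (linCurvSq H (plaq12At y)))) I₂).trans (step n₂ Sm₂)
  have FU := (Tilt.tiltExp_muD_le_gaussAvg H hβ0 hDpos ht0 hmU hUD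
    (fun a => sq_nonneg ((smallField H s).indicator (tiltU β H) a - b)) IU).trans (step nU SU)
  have FP₁ := (Tilt.tiltExp_muD_le_gaussAvg H hβ0 hDpos ht0 hmU hUD
    (fun a => mul_nonneg (sq_nonneg (chartPlaqCost H x 1 2 a - gaussAvg β H (linCurvSq H (plaq12At x))))
      (sq_nonneg ((smallField H s).indicator (tiltU β H) a - b))) IP₁).trans (step nP₁ SP₁)
  have FP₂ := (Tilt.tiltExp_muD_le_gaussAvg H hβ0 hDpos ht0 hmU hUD
    (fun a => mul_nonneg (sq_nonneg (chartPlaqCost H y 1 2 a - gaussAvg β H (linCurvSq H (plaq12At y))))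
      (sq_nonneg ((smallField H s).indicator (tiltU β H) a - b))) IP₂).trans (step nP₂ SP₂)
  -- the abstract fourth-cumulant bound with equal sizes for the two observables
  have hK := Tilt.abs_tiltCum4_le_of_moments
    (μ := (volume.restrict (smallField H s)).withDensity fun a => ENNReal.ofReal (gaussWeight β H a))
    hmU hm₁ hm₂ hUb h₁b h₂b t _ _ b F₁ F₂ FU FP₁ FP₂
  rw [sqrt_mul_sqrt_add_eq hP0 hM0 hMU0] at hK
  clear F₁ F₂ FU FP₁ FP₂
  refine hK.trans ?_
  clear hK
  -- final bookkeeping (pure real arithmetic, ✓`k4_bookkeeping`)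
  have hK0 : 0 ≤ 116 * s ^ 2 + 3 / (2 * β) := by positivity
  have hKle : 116 * s ^ 2 + 3 / (2 * β) ≤ 116 * (s ^ 2 + 1 / β) := by
    have hι0 : 0 ≤ 1 / β := by positivity
    have e1 : 3 / (2 * β) = 3 / 2 * (1 / β) := by ring
    have h1 : 3 / 2 * (1 / β) ≤ 116 * (1 / β) := mul_le_mul_of_nonneg_right (by norm_num) hι0
    rw [e1]
    linarith only [h1]
  have hXA : (H : ℝ) ^ 4 / β * (1 / β) ^ 2 = (H : ℝ) ^ 4 / β ^ 3 := by
    rw [one_div_pow, mul_one_div, div_div]; ring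
  have hm' : Real.exp 2 * (2 * (C_G * (1 + Real.log H) ^ 2 / β ^ 2)) ≤ Real.exp 2 * (2 * (C_G * (1 + Real.log H) ^ 2 * (1 / β) ^ 2)) :=
    le_of_eq (by rw [one_div_pow, ← div_eq_mul_one_div])
  have hmU' : Real.exp 2 * (2 * (2 * (max C₁₂ 0 * ((H : ℝ) ^ 4 / β) * (1 + Real.log H) ^ m₁₂) + 2 * RU)) ≤
      Real.exp 2 * (2 * (2 * (max C₁₂ 0 * ((H : ℝ) ^ 4 / β) * (1 + Real.log H) ^ m₁₂) + 2 * RU)) := le_rfl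
  have h := k4_bookkeeping (m_3 := m_3) (m₁₂ := m₁₂) (Real.one_le_exp (by norm_num : (0 : ℝ) ≤ 2)) hC_G0 hC_30 (le_max_right C₁₂ 0) hL1
    (by positivity : 0 ≤ (H : ℝ) ^ 4 / β ^ 3) (by positivity : 0 ≤ s ^ 6 * (H : ℝ) ^ 4 / β)
    (by positivity : 0 ≤ 1 / β) hXA (sq_nonneg s) hK0 hKle hRU0 hMU0 le_rfl hm' hmU'
  exact h

/-! ## Memo STEP 3 fully by name: `RU` discharged by ✓13K-U -/

/-- ★★ **`κ₄,t` over `μ_D`, memo STEP 3 fully by name** (`RU` of ✓`abs_tiltCum4_muD_le_of_sizes` discharged by fcl-p3's ✓13K-U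
`gaussAvg_sfInd_mul_sq_tiltU_add_cubicVertex_sub_le`, unconditional over ✓7d): there are `C ≥ 0`, `c₀ > 0`, `m` with
`|κ₄,t(c_x, c_y; tiltU, tiltU)| ≤ C·(1+log H)^m·(H⁴/β³ + s⁶H⁴/β + (s² + 1/β)²·(H⁸/β² + H¹²s⁶ + H⁸s⁸))` for `H ≥ 1`, `H⁴ ≤ β`, `0 ≤ s ≤ 1`,
`s·H² ≤ c₀`, `|tiltU β H| ≤ 1` on `smallField H s`, `E₀[1_{smallField s}] ≥ 1/2`, all base points `x, y`, all `t ∈ [0,1]`. -/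
theorem abs_tiltCum4_muD_le_explicit : ∃ C c₀ : ℝ, ∃ m : ℕ, 0 < c₀ ∧ 0 ≤ C ∧ ∀ H : ℕ, 1 ≤ H → ∀ β : ℝ, (H : ℝ) ^ 4 ≤ β →
    ∀ s : ℝ, 0 ≤ s → s ≤ 1 → s * (H : ℝ) ^ 2 ≤ c₀ → (∀ a ∈ smallField H s, |tiltU β H a| ≤ 1) → 1 / 2 ≤ gaussAvg β H (sfInd H s) →
    ∀ (x y : Site 4), ∀ t ∈ Set.Icc (0 : ℝ) 1,
      |Tilt.tiltCum4 ((volume.restrict (smallField H s)).withDensity fun a => ENNReal.ofReal (gaussWeight β H a))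
          (tiltU β H) t (chartPlaqCost H x 1 2) (chartPlaqCost H y 1 2)| ≤
        C * (1 + Real.log H) ^ m * ((H : ℝ) ^ 4 / β ^ 3 + s ^ 6 * (H : ℝ) ^ 4 / β +
          (s ^ 2 + 1 / β) ^ 2 * ((H : ℝ) ^ 8 / β ^ 2 + (H : ℝ) ^ 12 * s ^ 6 + (H : ℝ) ^ 8 * s ^ 8)) := by
  obtain ⟨C₁, m₁, hC₁, h₁⟩ := abs_tiltCum4_muD_le_of_sizes
  obtain ⟨C₂, c₀, m₂, hc₀, h₂⟩ := gaussAvg_sfInd_mul_sq_tiltU_add_cubicVertex_sub_le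
  refine ⟨C₁ * (1 + max C₂ 0), c₀, m₁ + m₂, hc₀, by positivity, fun H hH β hβ s hs0 hs1 hsH hU1 hD x y t ht => ?_⟩
  have hH1 : (1 : ℝ) ≤ H := by exact_mod_cast hH
  have hH4 : (1 : ℝ) ≤ (H : ℝ) ^ 4 := one_le_pow₀ hH1
  have hβ0 : 0 < β := lt_of_lt_of_le one_pos (hH4.trans hβ)
  have hL1 : 1 ≤ 1 + Real.log (H : ℝ) := by have := Real.log_nonneg hH1; linarith
  obtain ⟨b, hb⟩ := h₂ H hH β hβ s hs0 hs1 hsH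
  have hS0 : 0 ≤ (H : ℝ) ^ 8 / β ^ 2 + (H : ℝ) ^ 12 * s ^ 6 + (H : ℝ) ^ 8 * s ^ 8 := by positivity
  have hLm2 : 0 ≤ (1 + Real.log (H : ℝ)) ^ m₂ := by positivity
  have hRU : gaussAvg β H (fun a => sfInd H s a * (tiltU β H a + cubicVertex β H a - b) ^ 2) ≤
      max C₂ 0 * (1 + Real.log H) ^ m₂ * ((H : ℝ) ^ 8 / β ^ 2 + (H : ℝ) ^ 12 * s ^ 6 + (H : ℝ) ^ 8 * s ^ 8) :=
    hb.trans (mul_le_mul_of_nonneg_right (mul_le_mul_of_nonneg_right (le_max_left _ _) hLm2) hS0)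
  have hRU0 : 0 ≤ max C₂ 0 * (1 + Real.log H) ^ m₂ * ((H : ℝ) ^ 8 / β ^ 2 + (H : ℝ) ^ 12 * s ^ 6 + (H : ℝ) ^ 8 * s ^ 8) :=
    mul_nonneg (mul_nonneg (le_max_right _ _) hLm2) hS0
  have hmain := h₁ H hH β hβ s hs0 hs1 hU1 hD b _ hRU0 hRU x y t ht
  refine hmain.trans ?_
  exact k4_combine hC₁ (le_max_right C₂ 0) hL1 (by positivity) (by positivity) (sq_nonneg _) hS0

/-! ## The same in `β`-letters: `s = β^{−1/2+κ₃}` (ASSEMBLY-S5 §1), three monomials for ✓`ErrorBudget` -/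

/-- Powers of `s = β^a` as real powers of `β`. -/
theorem k4_rpow_pow_eq {β : ℝ} (hβ : 0 < β) (a : ℝ) (n : ℕ) : (β ^ a) ^ n = β ^ (a * n) := by
  rw [← Real.rpow_natCast, ← Real.rpow_mul hβ.le]

/-- **(e5) sizes in `β`-letters** (pure arithmetic): with `s = β^{−1/2+κ}`, `0 ≤ κ ≤ 1/6`, `β ≥ 1`, `X ≥ 0`:
`X⁴/β³ + s⁶X⁴/β + (s² + 1/β)²·(X⁸/β² + X¹²s⁶ + X⁸s⁸) ≤ 2·X⁴/β³ + 8·X⁸·β^{−4+4κ} + 4·X¹²·β^{−5+10κ}`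
(`s⁶/β = β^{−4+6κ} ≤ β^{−3}`, `1/β ≤ s²` so `(s²+1/β)² ≤ 4s⁴`, `s⁴/β² = β^{−4+4κ}`, `s¹⁰ = β^{−5+10κ}`, `s¹² ≤ β^{−4+4κ}`). -/
theorem k4_sizes_rpow_le {β κ X : ℝ} (hβ : 1 ≤ β) (hκ0 : 0 ≤ κ) (hκ : κ ≤ 1 / 6) (hX : 0 ≤ X) :
    X ^ 4 / β ^ 3 + (β ^ (-1 / 2 + κ)) ^ 6 * X ^ 4 / β +
        ((β ^ (-1 / 2 + κ)) ^ 2 + 1 / β) ^ 2 * (X ^ 8 / β ^ 2 + X ^ 12 * (β ^ (-1 / 2 + κ)) ^ 6 + X ^ 8 * (β ^ (-1 / 2 + κ)) ^ 8) ≤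
      2 * (X ^ 4 / β ^ 3) + 8 * (X ^ 8 * β ^ (-4 + 4 * κ)) + 4 * (X ^ 12 * β ^ (-5 + 10 * κ)) := by
  have hβ0 : 0 < β := lt_of_lt_of_le one_pos hβ
  set s := β ^ (-1 / 2 + κ) with hs
  have hsn : ∀ n : ℕ, s ^ n = β ^ ((-1 / 2 + κ) * n) := fun n => k4_rpow_pow_eq hβ0 _ n
  have mono : ∀ {a b : ℝ}, a ≤ b → β ^ a ≤ β ^ b := fun h => Real.rpow_le_rpow_of_exponent_le hβ h
  have hdiv : ∀ n : ℕ, (1 : ℝ) / β ^ n = β ^ (-(n : ℝ)) := fun n => by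
    rw [Real.rpow_neg hβ0.le, Real.rpow_natCast, one_div]
  -- (1) `s⁶X⁴/β ≤ X⁴/β³`
  have h1β : (1 : ℝ) / β = β ^ (-1 : ℝ) := by rw [Real.rpow_neg_one, one_div]
  have e1 : s ^ 6 * X ^ 4 / β = X ^ 4 * β ^ ((-1 / 2 + κ) * (6 : ℕ) + (-1 : ℝ)) := by
    rw [Real.rpow_add hβ0, ← hsn 6, Real.rpow_neg_one]; ring
  have e3 : X ^ 4 / β ^ 3 = X ^ 4 * β ^ (-((3 : ℕ) : ℝ)) := by rw [← hdiv 3]; ring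
  have h1 : s ^ 6 * X ^ 4 / β ≤ X ^ 4 / β ^ 3 := by
    rw [e1, e3]
    exact mul_le_mul_of_nonneg_left (mono (by push_cast; linarith)) (pow_nonneg hX 4)
  -- (2) `(s² + 1/β)² ≤ 4s⁴`
  have h2a : 1 / β ≤ s ^ 2 := by
    rw [hsn 2, h1β]
    exact mono (by push_cast; linarith)
  have h2 : (s ^ 2 + 1 / β) ^ 2 ≤ 4 * s ^ 4 := by
    have h0 : 0 ≤ s ^ 2 + 1 / β := by positivity
    calc (s ^ 2 + 1 / β) ^ 2 ≤ (s ^ 2 + s ^ 2) ^ 2 := pow_le_pow_left₀ h0 (by linarith) 2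
      _ = 4 * s ^ 4 := by ring
  -- (3) the three products with `4s⁴`
  have e4 : s ^ 4 / β ^ 2 = β ^ (-4 + 4 * κ) := by
    rw [div_eq_mul_one_div, hdiv 2, hsn 4, ← Real.rpow_add hβ0]
    congr 1; push_cast; ring
  have e10 : s ^ 4 * s ^ 6 = β ^ (-5 + 10 * κ) := by
    rw [← pow_add, hsn 10]
    congr 1; push_cast; ring
  have h12 : s ^ 4 * s ^ 8 ≤ β ^ (-4 + 4 * κ) := by
    rw [← pow_add, hsn 12]
    exact mono (by push_cast; linarith)
  have hT0 : 0 ≤ X ^ 8 / β ^ 2 + X ^ 12 * s ^ 6 + X ^ 8 * s ^ 8 := by positivity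
  have h3 : (s ^ 2 + 1 / β) ^ 2 * (X ^ 8 / β ^ 2 + X ^ 12 * s ^ 6 + X ^ 8 * s ^ 8) ≤
      4 * (X ^ 8 * β ^ (-4 + 4 * κ)) + 4 * (X ^ 12 * β ^ (-5 + 10 * κ)) + 4 * (X ^ 8 * β ^ (-4 + 4 * κ)) := by
    calc (s ^ 2 + 1 / β) ^ 2 * (X ^ 8 / β ^ 2 + X ^ 12 * s ^ 6 + X ^ 8 * s ^ 8)
        ≤ 4 * s ^ 4 * (X ^ 8 / β ^ 2 + X ^ 12 * s ^ 6 + X ^ 8 * s ^ 8) := mul_le_mul_of_nonneg_right h2 hT0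
      _ = 4 * (X ^ 8 * (s ^ 4 / β ^ 2)) + 4 * (X ^ 12 * (s ^ 4 * s ^ 6)) + 4 * (X ^ 8 * (s ^ 4 * s ^ 8)) := by ring
      _ ≤ 4 * (X ^ 8 * β ^ (-4 + 4 * κ)) + 4 * (X ^ 12 * β ^ (-5 + 10 * κ)) + 4 * (X ^ 8 * β ^ (-4 + 4 * κ)) := by
          rw [e4, e10]
          have := mul_le_mul_of_nonneg_left h12 (pow_nonneg hX 8)
          linarith
  have hA0 : 0 ≤ X ^ 4 / β ^ 3 := by positivity
  linarith

/-- ★★ **`κ₄,t` over `μ_D` in the ASSEMBLY-S5 §1 letters** (`s = β^{−1/2+κ₃}`, `0 ≤ κ₃ ≤ 1/6`): there are `C ≥ 0`, `c₀ > 0`, `m` such that for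
`H ≥ 1`, `H⁴ ≤ β`, `β^{−1/2+κ₃}·H² ≤ c₀`, `|tiltU β H| ≤ 1` on `smallField H (β^{−1/2+κ₃})` (✓`TiltSup.exists_forall_abs_tiltU_le_one`),
`E₀[1_{smallField}] ≥ 1/2`, all `x, y`, `t ∈ [0,1]`:
`|κ₄,t(c_x, c_y; tiltU, tiltU)| ≤ C·(1+log H)^m·(2·H⁴/β³ + 8·H⁸·β^{−4+4κ₃} + 4·H¹²·β^{−5+10κ₃})` — three monomials of ✓`ErrorBudget` shape
(relative sizes `H¹²/β`, `H¹⁶β^{−2+4κ₃}` = (e5) of ✓`errorBudget_six`, and `H²⁰β^{−3+10κ₃}`, all `→ 0` in the v13 window). -/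
theorem abs_tiltCum4_muD_le_rpow : ∃ C c₀ : ℝ, ∃ m : ℕ, 0 < c₀ ∧ 0 ≤ C ∧ ∀ H : ℕ, 1 ≤ H → ∀ β : ℝ, (H : ℝ) ^ 4 ≤ β →
    ∀ κ₃ : ℝ, 0 ≤ κ₃ → κ₃ ≤ 1 / 6 → β ^ (-1 / 2 + κ₃) * (H : ℝ) ^ 2 ≤ c₀ →
    (∀ a ∈ smallField H (β ^ (-1 / 2 + κ₃)), |tiltU β H a| ≤ 1) → 1 / 2 ≤ gaussAvg β H (sfInd H (β ^ (-1 / 2 + κ₃))) →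
    ∀ (x y : Site 4), ∀ t ∈ Set.Icc (0 : ℝ) 1,
      |Tilt.tiltCum4 ((volume.restrict (smallField H (β ^ (-1 / 2 + κ₃)))).withDensity fun a => ENNReal.ofReal (gaussWeight β H a))
          (tiltU β H) t (chartPlaqCost H x 1 2) (chartPlaqCost H y 1 2)| ≤
        C * (1 + Real.log H) ^ m *
          (2 * ((H : ℝ) ^ 4 / β ^ 3) + 8 * ((H : ℝ) ^ 8 * β ^ (-4 + 4 * κ₃)) + 4 * ((H : ℝ) ^ 12 * β ^ (-5 + 10 * κ₃))) := by
  obtain ⟨C, c₀, m, hc₀, hC, h⟩ := abs_tiltCum4_muD_le_explicit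
  refine ⟨C, c₀, m, hc₀, hC, fun H hH β hβ κ₃ hκ0 hκ hsH hU1 hD x y t ht => ?_⟩
  have hH1 : (1 : ℝ) ≤ H := by exact_mod_cast hH
  have hH4 : (1 : ℝ) ≤ (H : ℝ) ^ 4 := one_le_pow₀ hH1
  have hβ1 : 1 ≤ β := hH4.trans hβ
  have hs0 : 0 ≤ β ^ (-1 / 2 + κ₃) := Real.rpow_nonneg (zero_le_one.trans hβ1) _
  have hs1 : β ^ (-1 / 2 + κ₃) ≤ 1 := Real.rpow_le_one_of_one_le_of_nonpos hβ1 (by linarith)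
  have hL0 : 0 ≤ C * (1 + Real.log (H : ℝ)) ^ m := mul_nonneg hC (pow_nonneg (by have := Real.log_nonneg hH1; linarith) m)
  exact (h H hH β hβ _ hs0 hs1 hsH hU1 hD x y t ht).trans
    (mul_le_mul_of_nonneg_left (k4_sizes_rpow_le hβ1 hκ0 hκ (zero_le_one.trans hH1)) hL0)

end GaussNormalForm

end Summit.QuantumFields.YangMills.Theorems.AllWindowsColdBoxBoxHighLine

end
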